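import Mathlib
import Literature.Analysis.Convolution.YoungInequality
import Summits.NavierStokesRegularity.NavierStokesRegularity.Theorems.FilamentSkeletonRssTangentSkeletonNearStraightLSwirlBandGradientOdd

/-!
# The partner block's `L² → L²` scale by Young's inequality: `‖(σ²+D²)^{−3/2} ⋆ f‖₂ ≤ (2/D²)‖f‖₂`, `‖(σ²+D²)^{−5/2} ⋆ f‖₂ ≤ (4/(3D⁴))‖f‖₂`
# (`TangentSkeletonNearStraightL`, stmt-NavierStokesRegularity-23320; the `‖B‖ = O(γ/ρ²)` input of the strategist's (R♯-lo))

The crux strategist's census (`Cruxes/SkeletonJ1L/STRATEGY-CENSUS.md` PART III) records that the partner (coupling) block `B` of the linearised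
tangency operator is «a bounded evaluation-type operator at the partner's nearest point, strength `γ/(2πd̂²)`, NOT small, NOT compact», with
Γ-INDEPENDENT norm `‖B‖₂ ≈ 17.5` in the GP datum, and that (R♯-lo) must be a Gårding argument «bending symbol … dominates `‖S_⊥‖ + ‖B‖ =
O(γ/ρ²)`».  At MODEL level (straight partner at constant distance, arclength convolution) the typed content of `‖B‖ = O(γ/ρ²)` is Young's
inequality with the `L¹` masses landed in `…SwirlBandGradientOdd` (p826341: `∫(σ²+D²)^{−3/2} = 2/D²`, `∫(σ²+D²)^{−5/2} = 4/(3D⁴)`):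

* `partnerKernel_integrable` : the kernel `(σ²+D²)^{−3/2}` is integrable with `‖·‖_{L¹} = 2/D²` (as `ENNReal.ofReal`);
* `partnerKernel_convolution_L2_le` : `eLpNorm (K ⋆ f) 2 ≤ ENNReal.ofReal (2/D²) * eLpNorm f 2` for every a.e.-strongly measurable `f : ℝ → F`;
* `partnerKernel5_convolution_L2_le` : the same with `(σ²+D²)^{−5/2}` and `4/(3D⁴)`;
via `Literature.Analysis.Convolution.eLpNorm_convolution_le_young` (exponents `1, 2, 2`).

HONEST FRAMING: MODEL-level operator-norm bookkeeping for the linear theory of a HYPOTHETICAL filament skeleton on the NEGATIVE side of a MODEL route;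
no registered stub of 23320 is proved; nothing here bears on Navier–Stokes regularity or blow-up.  `--supports stmt-NavierStokesRegularity-23320`.
-/

set_option linter.dupNamespace false

noncomputable section

open Real Set MeasureTheory Filter Topology
open scoped ENNReal Convolution

namespace Summit.NavierStokesRegularity.NavierStokesRegularity.Theorems.TangentSkeletonNearStraightLSwirlBand

open Summit.NavierStokesRegularity.NavierStokesRegularity.Theorems.AnalyticStripLiaSymbol
open Summit.NavierStokesRegularity.NavierStokesRegularity.Theorems.AnalyticStripLiaSymbol.Numerics

variable {F : Type*} [NormedAddCommGroup F] [NormedSpace ℝ F]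

/-- The partner kernel `σ ↦ (σ²+D²)^{−3/2}` is integrable on `ℝ` with `L¹` norm `2/D²` (`D > 0`). [folklore] -/
theorem partnerKernel_integrable {D : ℝ} (hD : 0 < D) :
    Integrable (fun σ : ℝ => ((σ ^ 2 + D ^ 2) ^ (3 / 2 : ℝ))⁻¹) ∧
      eLpNorm (fun σ : ℝ => ((σ ^ 2 + D ^ 2) ^ (3 / 2 : ℝ))⁻¹) 1 volume = ENNReal.ofReal (2 / D ^ 2) := by
  have hmass := integral_inv_rpow_three_halves_mass hD
  have hint : Integrable (fun σ : ℝ => ((σ ^ 2 + D ^ 2) ^ (3 / 2 : ℝ))⁻¹) := by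
    refine Integrable.of_integral_ne_zero ?_
    rw [hmass]; positivity
  refine ⟨hint, ?_⟩
  have hnn : 0 ≤ᵐ[volume] fun σ : ℝ => ((σ ^ 2 + D ^ 2) ^ (3 / 2 : ℝ))⁻¹ :=
    Filter.Eventually.of_forall fun σ => by positivity
  rw [eLpNorm_one_eq_lintegral_enorm]
  simp_rw [← ofReal_norm, Real.norm_eq_abs]
  rw [← hmass, ofReal_integral_eq_lintegral_ofReal hint hnn]
  refine lintegral_congr fun σ => ?_
  rw [abs_of_nonneg (by positivity)]


/-- **The partner-block scale `‖K ⋆ ·‖_{L²→L²} ≤ 2/D²`**: convolution in arclength with the partner kernel `(σ²+D²)^{−3/2}` maps `L²`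
to `L²` with norm at most its `L¹` mass `2/D²` (Young, `1 + 1/2 = 1/1 + 1/2`).  With `D = d̂√Γ·(…)` and the prefactor `Γγ/4π` this is the
Γ-INDEPENDENT coupling scale `γ/(2πd̂²)` of the strategist's `‖B‖₂` (STRATEGY-CENSUS PART III). [folklore; Young's inequality =
`Literature.Analysis.Convolution.eLpNorm_convolution_le_young`] -/
theorem partnerKernel_convolution_L2_le {D : ℝ} (hD : 0 < D) {f : ℝ → F} (hf : AEStronglyMeasurable f volume) :
    eLpNorm ((fun σ : ℝ => ((σ ^ 2 + D ^ 2) ^ (3 / 2 : ℝ))⁻¹) ⋆[ContinuousLinearMap.lsmul ℝ ℝ, volume] f) 2 volume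
      ≤ ENNReal.ofReal (2 / D ^ 2) * eLpNorm f 2 volume := by
  obtain ⟨hint, hL1⟩ := partnerKernel_integrable hD
  have hY := Literature.Analysis.Convolution.eLpNorm_convolution_le_young (μ := volume) hint.aestronglyMeasurable hf
    (b := 1) (m := 2) (r := 2) le_rfl (by norm_num) (by norm_num)
  rwa [hL1] at hY

/-- The kernel-gradient power: `σ ↦ (σ²+D²)^{−5/2}` is integrable with `L¹` norm `4/(3D⁴)`, hence
`‖(σ²+D²)^{−5/2} ⋆ f‖_{L²} ≤ (4/(3D⁴))·‖f‖_{L²}`. [folklore] -/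
theorem partnerKernel5_convolution_L2_le {D : ℝ} (hD : 0 < D) {f : ℝ → F} (hf : AEStronglyMeasurable f volume) :
    eLpNorm ((fun σ : ℝ => ((σ ^ 2 + D ^ 2) ^ (5 / 2 : ℝ))⁻¹) ⋆[ContinuousLinearMap.lsmul ℝ ℝ, volume] f) 2 volume
      ≤ ENNReal.ofReal (4 / (3 * D ^ 4)) * eLpNorm f 2 volume := by
  have hmass := integral_inv_rpow_five_halves_mass hD
  have hint : Integrable (fun σ : ℝ => ((σ ^ 2 + D ^ 2) ^ (5 / 2 : ℝ))⁻¹) := by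
    refine Integrable.of_integral_ne_zero ?_
    rw [hmass]; positivity
  have hnn : 0 ≤ᵐ[volume] fun σ : ℝ => ((σ ^ 2 + D ^ 2) ^ (5 / 2 : ℝ))⁻¹ :=
    Filter.Eventually.of_forall fun σ => by positivity
  have hL1 : eLpNorm (fun σ : ℝ => ((σ ^ 2 + D ^ 2) ^ (5 / 2 : ℝ))⁻¹) 1 volume = ENNReal.ofReal (4 / (3 * D ^ 4)) := by
    rw [eLpNorm_one_eq_lintegral_enorm]
    simp_rw [← ofReal_norm, Real.norm_eq_abs]
    rw [← hmass, ofReal_integral_eq_lintegral_ofReal hint hnn]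
    refine lintegral_congr fun σ => ?_
    rw [abs_of_nonneg (by positivity)]
  have hY := Literature.Analysis.Convolution.eLpNorm_convolution_le_young (μ := volume) hint.aestronglyMeasurable hf
    (b := 1) (m := 2) (r := 2) le_rfl (by norm_num) (by norm_num)
  rwa [hL1] at hY

end Summit.NavierStokesRegularity.NavierStokesRegularity.Theorems.TangentSkeletonNearStraightLSwirlBand
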